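import Summits.BirchSwinnertonDyer.BirchSwinnertonDyer.Theorems.CyclotomicUntwistC1OfUniformRootLaw
import Summits.BirchSwinnertonDyer.BirchSwinnertonDyer.Theorems.CyclotomicUntwistUniformRootLaw
import HarnessLib

/-!
# Crux child C1 `PSUntwistedLFunctionAtThree` ⟸ PRINT BY NAME + Galois wildness at `3` (capstone of the
# print layer (T), lead file 4)

Cell `pub/bsd-wall` (D-0145 line `route-BirchSwinnertonDyer-CyclotomicUntwist`), seat `bsd-line-cycu-p1`
(K1/K2 LEAD lineage, gen 8). THEOREMS ONLY (no definition, no named fact, no `sorry`); helper toward the crux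
child C1 = stmt-BirchSwinnertonDyer-27548 (`--supports`; it does NOT close the item: the named print facts and
the wildness binder are hypotheses). BSD is not proved by this file; no crux of the route is proved by it.

WHAT. `psUntwistedLFunctionAtThree_of_print_of_wild`: C1 follows from SIX NAMED PRINT FACTS — modularity
(`nonempty_modularParametrizationData`), Carayol's level theorem (`IsNewformOf.level_eq_conductorNorm`),
Gross–Zagier I.(7.3) (`GrossZagier1986_thm_I_7_3`), Gross–Zagier–Kolyvagin (`PublishedInputGZK`), Deligne's
`ℓ`-adic representations of `Γ₁`-newforms (`Hida2000_thm326_exists_galoisRep`), Carayol's Thm. (A) in Euler-factor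
form (`Carayol1986_eulerFactor`) — plus ONE Galois-side binder on every principal-series row: WILDNESS of
`V₂(W)` at `3` (`∃ i ∈ I_𝔓`, `χ₉(i) = 4`, `ρ_{W,2}(i) ≠ 1`; dischargeable from `f₃(W) ≠ 2` — sibling file
`CyclotomicUntwistInertiaWildAtThree`, cycu-p3 g10). It is the composition of cycu-p4 g12's
`PSC1OfUniformRootLaw.psUntwistedLFunctionAtThree_of_print_of_uniformRootLaw` (C1 ⟸ four print facts + the
UNIFORM ROOT LAW) with the lead's `UniformRootLaw.uniformRootLaw_of_print` (the uniform root law ⟸ Deligne +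
Carayol + wildness; files 1, 2, 3a, 3b-i, 3b-ii, 3c: p646654, p647742, p648344, p649180, p649527, p650112).

References: [cite: CarayolASENS1986, Thm. (A)] · [cite: Hida2000, Thm. 3.26 (1)] · [cite: GrossZagier1986,
Thm. I.(7.3)] · [cite: MazurTateTeitelbaum1986Invent, §I.14] · [cite: DiamondShurman2005, Thm. 5.8.3].
-/

noncomputable section

open scoped MatrixGroups NumberField

open CongruenceSubgroup UpperHalfPlane NumberField IsDedekindDomain Field
  Literature.NumberTheory.EllipticCurves Literature.NumberTheory.EllipticCurves.ModularForms
  Literature.NumberTheory.EllipticCurves.Rank1Residual Literature.NumberTheory.IwasawaTheory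
  Literature.NumberTheory.GaloisRepresentations
  Summit.BirchSwinnertonDyer.BirchSwinnertonDyer.Theses.CyclotomicUntwist
  Summit.BirchSwinnertonDyer.Rank1Residual.Additive

-- single-conjunct summit: `Summit.BirchSwinnertonDyer.BirchSwinnertonDyer.…` repeats the name by design
set_option linter.dupNamespace false
set_option autoImplicit false

namespace Summit.BirchSwinnertonDyer.BirchSwinnertonDyer.Theorems.PSC1OfPrint

/-- **C1 `PSUntwistedLFunctionAtThree` ⟸ six named print facts + Galois wildness at `3` on every
principal-series row.** Composition of `PSC1OfUniformRootLaw.psUntwistedLFunctionAtThree_of_print_of_uniformRootLaw`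
(cycu-p4 g12) with `UniformRootLaw.uniformRootLaw_of_print` (lead). [cite: CarayolASENS1986, Thm. (A)]
[cite: Hida2000, Thm. 3.26 (1)] [cite: GrossZagier1986, Thm. I.(7.3)] [cite: MazurTateTeitelbaum1986Invent, §I.14] -/
theorem psUntwistedLFunctionAtThree_of_print_of_wild
    (hmod : nonempty_modularParametrizationData)
    (hlev : ∀ (N : ℕ) [NeZero N], IsNewformOf.level_eq_conductorNorm (N := N))
    (hGZ86 : GrossZagier1986_thm_I_7_3) (hGZK : PublishedInputGZK)
    (hD : Hida2000_thm326_exists_galoisRep) (hC : Carayol1986_eulerFactor)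
    (hwild : ∀ (W : WeierstrassCurve ℚ) [W.IsElliptic] [W.IsGloballyMinimal], ClassO6 W 3 →
      Even (padicValInt 3 W.minimalDiscriminantInt) →
      W.minimalDiscriminantInt / 3 ^ padicValInt 3 W.minimalDiscriminantInt % 3 = 1 →
      ∃ (v : HeightOneSpectrum (𝓞 ℚ)) (𝔓 : Ideal (absIntegers (𝓞 ℚ) ℚ)), 𝔓 ∈ v.primesAbove ∧
        (3 : 𝓞 ℚ) ∈ v.asIdeal ∧ ∃ i ∈ 𝔓.inertia (absoluteGaloisGroup ℚ),
          (modNCyclotomicCharacter ℚ 9 i : ZMod 9) = 4 ∧ W.rationalGaloisRepTate 2 i ≠ 1) :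
    PSUntwistedLFunctionAtThree :=
  PSC1OfUniformRootLaw.psUntwistedLFunctionAtThree_of_print_of_uniformRootLaw hmod hlev hGZ86 hGZK
    fun W _ _ _ hO6 _ hev hsq _ =>
      UniformRootLaw.uniformRootLaw_of_print W hD hC hO6 hev hsq (hwild W hO6 hev hsq)

end Summit.BirchSwinnertonDyer.BirchSwinnertonDyer.Theorems.PSC1OfPrint

end
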